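import Literature.NumberTheory.Weil1965.SplitPlaceFibreMeasureInvariance
import HarnessLib

/-!
# Weil's closure at a split place: two invariant measures on `X_v × Y` with proportional dilated-box masses are proportional

Topic `NumberTheory/Weil1965`; namespace `Literature.NumberTheory.Weil1965.SplitPlace`.  KERNEL ONLY: theorems; no definition, no
named fact, no instance, no `sorry`.

The ABSTRACT CORE of the I-CLOSE step of the Siegel–Weil identity (A. Weil, *Acta Math.* 113 (1965), n° 51, proof of Thm 4,
pp. 73–74, run at one finite place `v` split in `E`).  `X_v := K^ι × K^ι` (`K` a non-archimedean local field, `|ι| ≥ 2`) carries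
the `GL_ι(K)`-action `(x, y) ↦ (g x, (g⁻¹)ᵀ y)` with orbits `S_b = {x ⬝ᵥ y = b, x ≠ 0, y ≠ 0}` and the fibre measures
`μ_{b,v} = fibreMeasure μ hι b` (★ `SplitPlaceFibreMeasure`, `SplitPlaceFibreMeasureInvariance`).  `Y` is ANY measurable space
(in the application: the prime-to-`v` adelic factor `X□(𝔸^{(v)})`), `𝔅` a π-system of subsets of `Y` generating its σ-algebra and
containing an increasing countable cover (the relatively compact standard opens).

* §1 `exists_rect_eq_mul_fibreMeasure_sub` — for two measures `μ₁, μ₂` on `X_v × Y` whose `B`-rectangle masses (`B ∈ 𝔅`) are finite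
  on compacts, `GL`-invariant and carried by `S_b × B`, the relative Lemme 22 (★ `exists_measure_prod_splitLocus_eq_mul_fibreMeasure`)
  gives `μ_i(A × B) = c_i(B) · μ_{b,v}(A)`; hence **`μ₁(A × B) − κ μ₂(A × B) = (c₁(B) − κ c₂(B)) · μ_{b,v}(A)`** on every Borel `A`.
* §2 **`measure_eq_smul_of_rect_eq`** — if `μ₁(A × B) = κ · μ₂(A × B)` for all Borel `A ⊆ X_v` and `B ∈ 𝔅`, then `μ₁ = κ • μ₂`
  (π-system uniqueness on the rectangles `A × B`, countable cover `(𝔭^{-n})^ι² × Y_n`).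
* §3 **`measure_eq_smul_of_coeff_eq`** — so it suffices that the two constants agree, `c₁(B) = κ c₂(B)`, for every `B ∈ 𝔅`; and
  **`toReal_rect_dilBox_sub_eq`** rewrites the difference of the masses of the DILATED BOXES `D_t × B`,
  `D_t := {(x, y) | t⁻¹x ∈ 𝒪^ι, y ∈ 𝒪^ι}`, as `(c₁(B) − κ c₂(B)) · ∫ 𝟙_{𝒪^ι×𝒪^ι}(t⁻¹ • x, y) dμ_{b,v}` — the quantity that Weil's
  (39)–(40) bound (`≤ M‖t‖^γ`, `γ < |ι| − 1`, from the boundedness of `E'' = E′ − E` on the metaplectic group) forces to have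
  `c₁(B) − κ c₂(B) = 0` (the scaling `‖t‖^{|ι|−1} F(b/t)`, `F(b/t) → F(0) ≠ 0`: `SplitPlaceCoefficientVanishing`).

USE (cell `hodgecm-mathlib`, FLOOR-0 P4, ENGINE E-2 child `Cruxes/H413/Lines/F0_E2SiegelWeilWeilRange.lean`, `StubSW2` (iii), pen's sheet
`SW2-ICLOSE-ASSEMBLY.v0` §2 steps (2)–(4)): `μ₁ := (β_v × id)_* μ̂_b` (theta side), `μ₂ := (β_v × id)_* μ_b` (Eisenstein side),
`κ := ν([U(J_V)])`.  HC_CM is proved only modulo the printed citations until rung 0 closes.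
-/

namespace Literature.NumberTheory.Weil1965.SplitPlace

open _root_.MeasureTheory _root_.Filter _root_.Set Literature.NumberTheory.Automorphic
open Literature.NumberTheory.Automorphic.LocalFieldHaar
open _root_.Topology
open scoped Pointwise NNReal ENNReal Matrix
open Literature.NumberTheory.GaloisRepresentations.IsNonarchimedeanLocalField
open MeasurableSpace (generateFrom)

variable {K : Type*} [Field K] [ValuativeRel K] [TopologicalSpace K] [IsNonarchimedeanLocalField K]
variable {ι : Type*} [Fintype ι] [MeasurableSpace K] [BorelSpace K] (μ : Measure K) [μ.IsAddHaarMeasure]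

omit [MeasurableSpace K] [BorelSpace K] in
/-- instance helper: `K` is second countable. [folklore] -/
private theorem secondCountableC : SecondCountableTopology K := secondCountableTopology_localField K

omit [MeasurableSpace K] [BorelSpace K] in
/-- instance helper: `K` is Hausdorff. [folklore] -/
private theorem t2C : T2Space K :=
  (Literature.NumberTheory.GaloisRepresentations.IsNonarchimedeanLocalField.isLocalField K).toT2Space

/-! ## §1 The two constants of a pair of invariant measures -/

/-- **TWO INVARIANT MEASURES, ONE REFERENCE**: if `μ₁`, `μ₂` on `X_v × Y` both have finite, `GL_ι(K)`-invariant `B`-rectangle masses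
carried by `S_b × B`, then `μ₁(A × B) − κ·μ₂(A × B) = (c₁ − κ c₂) · μ_{b,v}(A)` for the two constants of the relative Lemme 22 — the
signed combination `μ'' = μ̂ − κ μ` of Weil's proof, tested on rectangles, without signed measures.
[cite: Weil1965, Chap. V n° 49 Lemma 22, p. 70] -/
theorem exists_rect_eq_mul_fibreMeasure_sub [Nonempty ι] [DecidableEq ι] [MeasurableSingletonClass K]
    (hι : 2 ≤ Fintype.card ι) (b : K) {Y : Type*} [MeasurableSpace Y]
    (μ₁ μ₂ : Measure (((ι → K) × (ι → K)) × Y)) (κ : ℝ≥0) {B : Set Y}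
    (hfin₁ : ∀ C : Set ((ι → K) × (ι → K)), IsCompact C → μ₁ (C ×ˢ B) < ⊤)
    (hfin₂ : ∀ C : Set ((ι → K) × (ι → K)), IsCompact C → μ₂ (C ×ˢ B) < ⊤)
    (hinv₁ : ∀ (g : GL ι K) (A : Set ((ι → K) × (ι → K))), MeasurableSet A →
      μ₁ (((fun z => (((g : Matrix ι ι K) *ᵥ z.1, ((g⁻¹ : GL ι K) : Matrix ι ι K)ᵀ *ᵥ z.2) :
        (ι → K) × (ι → K))) ⁻¹' A) ×ˢ B) = μ₁ (A ×ˢ B))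
    (hinv₂ : ∀ (g : GL ι K) (A : Set ((ι → K) × (ι → K))), MeasurableSet A →
      μ₂ (((fun z => (((g : Matrix ι ι K) *ᵥ z.1, ((g⁻¹ : GL ι K) : Matrix ι ι K)ᵀ *ᵥ z.2) :
        (ι → K) × (ι → K))) ⁻¹' A) ×ˢ B) = μ₂ (A ×ˢ B))
    (hcar₁ : μ₁ ({z : (ι → K) × (ι → K) | z.1 ⬝ᵥ z.2 = b ∧ z.1 ≠ 0 ∧ z.2 ≠ 0}ᶜ ×ˢ B) = 0)
    (hcar₂ : μ₂ ({z : (ι → K) × (ι → K) | z.1 ⬝ᵥ z.2 = b ∧ z.1 ≠ 0 ∧ z.2 ≠ 0}ᶜ ×ˢ B) = 0) :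
    ∃ c₁ c₂ : ℝ≥0, (∀ A : Set ((ι → K) × (ι → K)), MeasurableSet A → μ₁ (A ×ˢ B) = c₁ * fibreMeasure μ hι b A) ∧
      (∀ A : Set ((ι → K) × (ι → K)), MeasurableSet A → μ₂ (A ×ˢ B) = c₂ * fibreMeasure μ hι b A) ∧
      ∀ A : Set ((ι → K) × (ι → K)), MeasurableSet A → fibreMeasure μ hι b A < ⊤ →
        (μ₁ (A ×ˢ B)).toReal - κ * (μ₂ (A ×ˢ B)).toReal =
          ((c₁ : ℝ) - κ * c₂) * (fibreMeasure μ hι b A).toReal := by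
  obtain ⟨c₁, hc₁⟩ := exists_measure_prod_splitLocus_eq_mul_fibreMeasure μ hι b μ₁ hfin₁ hinv₁ hcar₁
  obtain ⟨c₂, hc₂⟩ := exists_measure_prod_splitLocus_eq_mul_fibreMeasure μ hι b μ₂ hfin₂ hinv₂ hcar₂
  refine ⟨c₁, c₂, hc₁, hc₂, fun A hA _ => ?_⟩
  rw [hc₁ A hA, hc₂ A hA, ENNReal.toReal_mul, ENNReal.toReal_mul, ENNReal.coe_toReal, ENNReal.coe_toReal]
  ring

/-! ## §2 Uniqueness from rectangles -/

omit [Field K] [ValuativeRel K] [TopologicalSpace K] [IsNonarchimedeanLocalField K] [Fintype ι] [BorelSpace K]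
  [μ.IsAddHaarMeasure] in
/-- the rectangles `A × B`, `A ⊆ X_v` Borel, `B ∈ 𝔅`, form a π-system generating the product σ-algebra when `𝔅` is a generating
π-system of `Y` with a countable cover. [cite: Weil1965, Chap. V n° 49 Lemma 22, p. 70] -/
theorem generateFrom_rect_eq {Y : Type*} [MeasurableSpace Y] (𝔅 : Set (Set Y))
    (h𝔅gen : generateFrom 𝔅 = ‹MeasurableSpace Y›) (h𝔅span : IsCountablySpanning 𝔅) :
    generateFrom (image2 (· ×ˢ ·) {A : Set ((ι → K) × (ι → K)) | MeasurableSet A} 𝔅) =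
      (Prod.instMeasurableSpace : MeasurableSpace (((ι → K) × (ι → K)) × Y)) :=
  generateFrom_eq_prod MeasurableSpace.generateFrom_measurableSet h𝔅gen isCountablySpanning_measurableSet h𝔅span

/-- **UNIQUENESS FROM RECTANGLES**: two measures on `X_v × Y` agreeing (up to the factor `κ`) on all rectangles `A × B` (`A` Borel,
`B ∈ 𝔅`) agree, provided `𝔅` is a generating π-system of `Y` containing an increasing cover `(Y_n)` with `μ₁((𝔭^{-n})^ι² × Y_n) < ∞`.
[cite: Weil1965, Chap. V n° 49 Lemma 22, p. 70] -/
theorem measure_eq_smul_of_rect_eq {Y : Type*} [MeasurableSpace Y] (𝔅 : Set (Set Y)) (h𝔅pi : IsPiSystem 𝔅)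
    (h𝔅gen : generateFrom 𝔅 = ‹MeasurableSpace Y›) (Yc : ℕ → Set Y) (hYc : ∀ n, Yc n ∈ 𝔅) (hYmono : Monotone Yc)
    (hYu : ⋃ n, Yc n = univ) (μ₁ μ₂ : Measure (((ι → K) × (ι → K)) × Y)) (κ : ℝ≥0)
    (hfin : ∀ n : ℕ, μ₁ ((piPrimePowBall K ι (-(n : ℤ)) ×ˢ piPrimePowBall K ι (-(n : ℤ))) ×ˢ Yc n) < ⊤)
    (hrect : ∀ B ∈ 𝔅, ∀ A : Set ((ι → K) × (ι → K)), MeasurableSet A → μ₁ (A ×ˢ B) = κ * μ₂ (A ×ˢ B)) :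
    μ₁ = κ • μ₂ := by
  haveI : SecondCountableTopology K := secondCountableC
  have hspan : IsCountablySpanning 𝔅 := ⟨Yc, hYc, hYu⟩
  refine Measure.ext_of_generateFrom_of_iUnion (image2 (· ×ˢ ·) {A : Set ((ι → K) × (ι → K)) | MeasurableSet A} 𝔅)
    (fun n => (piPrimePowBall K ι (-(n : ℤ)) ×ˢ piPrimePowBall K ι (-(n : ℤ))) ×ˢ Yc n)
    (generateFrom_rect_eq (K := K) (ι := ι) 𝔅 h𝔅gen hspan).symm (MeasurableSpace.isPiSystem_measurableSet.prod h𝔅pi) ?_ ?_ ?_ ?_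
  · -- the cover exhausts `X_v × Y`
    apply Set.eq_univ_of_forall
    rintro ⟨z, y⟩
    obtain ⟨k₁, hk₁⟩ := exists_mem_piPrimePowBall z.1
    obtain ⟨k₂, hk₂⟩ := exists_mem_piPrimePowBall z.2
    have hy : y ∈ ⋃ n, Yc n := by rw [hYu]; exact mem_univ y
    obtain ⟨k₃, hk₃⟩ := Set.mem_iUnion.1 hy
    refine Set.mem_iUnion.2 ⟨max (max k₁ k₂) k₃, ⟨⟨?_, ?_⟩, ?_⟩⟩
    · exact piPrimePowBall_antitone (by simp) hk₁
    · exact piPrimePowBall_antitone (by simp) hk₂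
    · exact hYmono (le_max_right _ _) hk₃
  · intro n
    exact ⟨_, (measurableSet_piPrimePowBall' (-(n : ℤ))).prod (measurableSet_piPrimePowBall' (-(n : ℤ))), _, hYc n, rfl⟩
  · intro n
    exact (hfin n).ne
  · rintro _ ⟨A, hA, B, hB, rfl⟩
    rw [hrect B hB A hA, Measure.smul_apply, ENNReal.smul_def, smul_eq_mul]

/-! ## §3 Reduction to the vanishing of one coefficient per `B`, and the dilated boxes -/

/-- **IT SUFFICES THAT THE TWO CONSTANTS AGREE**: under the hypotheses of §1 for every `B ∈ 𝔅` (a generating π-system with an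
increasing cover), if for each `B ∈ 𝔅` SOME Borel `A_B` of positive finite `μ_{b,v}`-mass has `μ₁(A_B × B) = κ μ₂(A_B × B)`, then
`μ₁ = κ • μ₂`. [cite: Weil1965, Chap. V n° 50 Thm 4, p. 72] -/
theorem measure_eq_smul_of_coeff_eq [Nonempty ι] [DecidableEq ι] [MeasurableSingletonClass K]
    (hι : 2 ≤ Fintype.card ι) (b : K) {Y : Type*} [MeasurableSpace Y] (𝔅 : Set (Set Y)) (h𝔅pi : IsPiSystem 𝔅)
    (h𝔅gen : generateFrom 𝔅 = ‹MeasurableSpace Y›) (Yc : ℕ → Set Y) (hYc : ∀ n, Yc n ∈ 𝔅) (hYmono : Monotone Yc)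
    (hYu : ⋃ n, Yc n = univ) (μ₁ μ₂ : Measure (((ι → K) × (ι → K)) × Y)) (κ : ℝ≥0)
    (hfin₁ : ∀ B ∈ 𝔅, ∀ C : Set ((ι → K) × (ι → K)), IsCompact C → μ₁ (C ×ˢ B) < ⊤)
    (hfin₂ : ∀ B ∈ 𝔅, ∀ C : Set ((ι → K) × (ι → K)), IsCompact C → μ₂ (C ×ˢ B) < ⊤)
    (hinv₁ : ∀ B ∈ 𝔅, ∀ (g : GL ι K) (A : Set ((ι → K) × (ι → K))), MeasurableSet A →
      μ₁ (((fun z => (((g : Matrix ι ι K) *ᵥ z.1, ((g⁻¹ : GL ι K) : Matrix ι ι K)ᵀ *ᵥ z.2) :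
        (ι → K) × (ι → K))) ⁻¹' A) ×ˢ B) = μ₁ (A ×ˢ B))
    (hinv₂ : ∀ B ∈ 𝔅, ∀ (g : GL ι K) (A : Set ((ι → K) × (ι → K))), MeasurableSet A →
      μ₂ (((fun z => (((g : Matrix ι ι K) *ᵥ z.1, ((g⁻¹ : GL ι K) : Matrix ι ι K)ᵀ *ᵥ z.2) :
        (ι → K) × (ι → K))) ⁻¹' A) ×ˢ B) = μ₂ (A ×ˢ B))
    (hcar₁ : ∀ B ∈ 𝔅, μ₁ ({z : (ι → K) × (ι → K) | z.1 ⬝ᵥ z.2 = b ∧ z.1 ≠ 0 ∧ z.2 ≠ 0}ᶜ ×ˢ B) = 0)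
    (hcar₂ : ∀ B ∈ 𝔅, μ₂ ({z : (ι → K) × (ι → K) | z.1 ⬝ᵥ z.2 = b ∧ z.1 ≠ 0 ∧ z.2 ≠ 0}ᶜ ×ˢ B) = 0)
    (hcoeff : ∀ B ∈ 𝔅, ∃ A : Set ((ι → K) × (ι → K)), MeasurableSet A ∧ fibreMeasure μ hι b A ≠ 0 ∧
      fibreMeasure μ hι b A < ⊤ ∧ μ₁ (A ×ˢ B) = κ * μ₂ (A ×ˢ B)) :
    μ₁ = κ • μ₂ := by
  refine measure_eq_smul_of_rect_eq 𝔅 h𝔅pi h𝔅gen Yc hYc hYmono hYu μ₁ μ₂ κ (fun n => hfin₁ _ (hYc n) _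
    ((isCompact_piPrimePowBall _).prod (isCompact_piPrimePowBall _))) fun B hB A hA => ?_
  obtain ⟨c₁, c₂, hc₁, hc₂, -⟩ := exists_rect_eq_mul_fibreMeasure_sub μ hι b μ₁ μ₂ κ (hfin₁ B hB) (hfin₂ B hB)
    (hinv₁ B hB) (hinv₂ B hB) (hcar₁ B hB) (hcar₂ B hB)
  obtain ⟨A₀, hA₀, hA₀0, hA₀top, hA₀eq⟩ := hcoeff B hB
  -- the constants agree: `c₁ m = κ c₂ m` with `0 < m < ∞`
  have hceq : (c₁ : ℝ≥0∞) = κ * c₂ := by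
    have h := hA₀eq
    rw [hc₁ A₀ hA₀, hc₂ A₀ hA₀, ← mul_assoc] at h
    exact (ENNReal.mul_left_inj hA₀0 hA₀top.ne).1 h
  rw [hc₁ A hA, hc₂ A hA, ← mul_assoc, hceq]

omit [ValuativeRel K] [TopologicalSpace K] [IsNonarchimedeanLocalField K] [Fintype ι] [MeasurableSpace K] [BorelSpace K] in
/-- the dilated box `D_t = {(x, y) | t⁻¹ • x ∈ 𝒪^ι, y ∈ 𝒪^ι}` is the support of `𝟙_{𝒪^ι × 𝒪^ι}(t⁻¹ • x, y)`.
[cite: Weil1965, Chap. V n° 50 (40), p. 74] -/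
theorem indicator_dilBox_eq [ValuativeRel K] [TopologicalSpace K] [IsNonarchimedeanLocalField K] (t : K)
    (z : (ι → K) × (ι → K)) :
    ({z : (ι → K) × (ι → K) | t⁻¹ • z.1 ∈ piPrimePowBall K ι 0 ∧ z.2 ∈ piPrimePowBall K ι 0}).indicator (fun _ => (1 : ℝ)) z =
      (piPrimePowBall K ι 0 ×ˢ piPrimePowBall K ι 0).indicator (fun _ => (1 : ℝ)) (t⁻¹ • z.1, z.2) := by
  by_cases hz : t⁻¹ • z.1 ∈ piPrimePowBall K ι 0 ∧ z.2 ∈ piPrimePowBall K ι 0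
  · rw [Set.indicator_of_mem (show z ∈ {z : (ι → K) × (ι → K) | t⁻¹ • z.1 ∈ piPrimePowBall K ι 0 ∧
        z.2 ∈ piPrimePowBall K ι 0} from hz), Set.indicator_of_mem (Set.mk_mem_prod hz.1 hz.2)]
  · rw [Set.indicator_of_notMem (show z ∉ {z : (ι → K) × (ι → K) | t⁻¹ • z.1 ∈ piPrimePowBall K ι 0 ∧
        z.2 ∈ piPrimePowBall K ι 0} from hz), Set.indicator_of_notMem (fun h => hz ⟨h.1, h.2⟩)]

/-- the dilated box is Borel. [cite: Weil1965, Chap. V n° 50 (40), p. 74] -/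
theorem measurableSet_dilBox (t : K) :
    MeasurableSet {z : (ι → K) × (ι → K) | t⁻¹ • z.1 ∈ piPrimePowBall K ι 0 ∧ z.2 ∈ piPrimePowBall K ι 0} := by
  haveI : SecondCountableTopology K := secondCountableC
  have h1 : Measurable fun z : (ι → K) × (ι → K) => t⁻¹ • z.1 := (measurable_const_smul t⁻¹).comp measurable_fst
  exact ((measurableSet_piPrimePowBall' 0).preimage h1).inter ((measurableSet_piPrimePowBall' 0).preimage measurable_snd)

omit [Fintype ι] [MeasurableSpace K] [BorelSpace K] in
/-- the dilated box (for `t ≠ 0`) is compact: it is `(t • 𝒪^ι) × 𝒪^ι`. [cite: Weil1965, Chap. V n° 50 (40), p. 74] -/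
theorem isCompact_dilBox {t : K} (ht : t ≠ 0) :
    IsCompact {z : (ι → K) × (ι → K) | t⁻¹ • z.1 ∈ piPrimePowBall K ι 0 ∧ z.2 ∈ piPrimePowBall K ι 0} := by
  have hset : {z : (ι → K) × (ι → K) | t⁻¹ • z.1 ∈ piPrimePowBall K ι 0 ∧ z.2 ∈ piPrimePowBall K ι 0} =
      ((fun x : ι → K => t • x) '' piPrimePowBall K ι 0) ×ˢ piPrimePowBall K ι 0 := by
    ext z
    simp only [mem_setOf_eq, mem_prod, mem_image]
    constructor
    · rintro ⟨h1, h2⟩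
      exact ⟨⟨t⁻¹ • z.1, h1, by rw [smul_smul, mul_inv_cancel₀ ht, one_smul]⟩, h2⟩
    · rintro ⟨⟨x, hx, hxz⟩, h2⟩
      refine ⟨?_, h2⟩
      rw [← hxz, smul_smul, inv_mul_cancel₀ ht, one_smul]
      exact hx
  rw [hset]
  exact ((isCompact_piPrimePowBall 0).image (continuous_const_smul t)).prod (isCompact_piPrimePowBall 0)

/-- **THE DILATED-BOX MASSES**: `μ₁(D_t × B) − κ μ₂(D_t × B) = (c₁ − κ c₂) · ∫ 𝟙_{𝒪^ι×𝒪^ι}(t⁻¹ • x, y) dμ_{b,v}` — the left side is what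
Weil's bound (39) controls (`≤ M‖t‖^γ`), the integral on the right is what the scaling law (40) evaluates (`‖t‖^{|ι|−1} F(b/t)`).
[cite: Weil1965, Chap. V n° 50 (40), p. 74] -/
theorem toReal_rect_dilBox_sub_eq [Nonempty ι] [DecidableEq ι] [MeasurableSingletonClass K]
    (hι : 2 ≤ Fintype.card ι) (b : K) {Y : Type*} [MeasurableSpace Y]
    (μ₁ μ₂ : Measure (((ι → K) × (ι → K)) × Y)) (κ : ℝ≥0) {B : Set Y} {c₁ c₂ : ℝ≥0}
    (hsub : ∀ A : Set ((ι → K) × (ι → K)), MeasurableSet A → fibreMeasure μ hι b A < ⊤ →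
      (μ₁ (A ×ˢ B)).toReal - κ * (μ₂ (A ×ˢ B)).toReal = ((c₁ : ℝ) - κ * c₂) * (fibreMeasure μ hι b A).toReal)
    {t : K} (ht : t ≠ 0) :
    (μ₁ ({z : (ι → K) × (ι → K) | t⁻¹ • z.1 ∈ piPrimePowBall K ι 0 ∧ z.2 ∈ piPrimePowBall K ι 0} ×ˢ B)).toReal -
        κ * (μ₂ ({z : (ι → K) × (ι → K) | t⁻¹ • z.1 ∈ piPrimePowBall K ι 0 ∧ z.2 ∈ piPrimePowBall K ι 0} ×ˢ B)).toReal =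
      ((c₁ : ℝ) - κ * c₂) *
        ∫ z, (piPrimePowBall K ι 0 ×ˢ piPrimePowBall K ι 0).indicator (fun _ => (1 : ℝ)) (t⁻¹ • z.1, z.2)
          ∂(fibreMeasure μ hι b) := by
  haveI := isFiniteMeasureOnCompacts_fibreMeasure μ hι b
  have hD := measurableSet_dilBox (K := K) (ι := ι) t
  have hDtop : fibreMeasure μ hι b {z : (ι → K) × (ι → K) | t⁻¹ • z.1 ∈ piPrimePowBall K ι 0 ∧ z.2 ∈ piPrimePowBall K ι 0} < ⊤ :=
    (isCompact_dilBox (K := K) (ι := ι) ht).measure_lt_top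
  rw [hsub _ hD hDtop]
  congr 1
  rw [← measureReal_def, ← integral_indicator_one hD]
  refine integral_congr_ae (Eventually.of_forall fun z => ?_)
  have h1 : ({z : (ι → K) × (ι → K) | t⁻¹ • z.1 ∈ piPrimePowBall K ι 0 ∧ z.2 ∈ piPrimePowBall K ι 0}).indicator
      (1 : (ι → K) × (ι → K) → ℝ) z =
      ({z : (ι → K) × (ι → K) | t⁻¹ • z.1 ∈ piPrimePowBall K ι 0 ∧ z.2 ∈ piPrimePowBall K ι 0}).indicator
        (fun _ => (1 : ℝ)) z := rfl
  rw [h1]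
  exact indicator_dilBox_eq (K := K) (ι := ι) t z

/-- **WEIL'S CLOSURE AT A SPLIT PLACE (abstract form)**: two measures on `X_v × Y` with finite, `GL_ι(K)`-invariant `𝔅`-rectangle
masses carried by `S_b × B` coincide up to `κ` as soon as, for each `B ∈ 𝔅`, the difference of their dilated-box masses vanishes for
ONE `t ≠ 0` with `∫ 𝟙_{𝒪^ι×𝒪^ι}(t⁻¹ • x, y) dμ_{b,v} ≠ 0` — in the application this comes from `SplitPlaceCoefficientVanishing`
(`c₁ − κ c₂ = 0` from the (39)–(40) bound along `‖t‖ → ∞`). [cite: Weil1965, Chap. V n° 50 Thm 4, p. 72] -/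
theorem measure_eq_smul_of_sub_eq_zero [Nonempty ι] [DecidableEq ι] [MeasurableSingletonClass K]
    (hι : 2 ≤ Fintype.card ι) (b : K) {Y : Type*} [MeasurableSpace Y] (𝔅 : Set (Set Y)) (h𝔅pi : IsPiSystem 𝔅)
    (h𝔅gen : generateFrom 𝔅 = ‹MeasurableSpace Y›) (Yc : ℕ → Set Y) (hYc : ∀ n, Yc n ∈ 𝔅) (hYmono : Monotone Yc)
    (hYu : ⋃ n, Yc n = univ) (μ₁ μ₂ : Measure (((ι → K) × (ι → K)) × Y)) (κ : ℝ≥0)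
    (hfin₁ : ∀ B ∈ 𝔅, ∀ C : Set ((ι → K) × (ι → K)), IsCompact C → μ₁ (C ×ˢ B) < ⊤)
    (hfin₂ : ∀ B ∈ 𝔅, ∀ C : Set ((ι → K) × (ι → K)), IsCompact C → μ₂ (C ×ˢ B) < ⊤)
    (hinv₁ : ∀ B ∈ 𝔅, ∀ (g : GL ι K) (A : Set ((ι → K) × (ι → K))), MeasurableSet A →
      μ₁ (((fun z => (((g : Matrix ι ι K) *ᵥ z.1, ((g⁻¹ : GL ι K) : Matrix ι ι K)ᵀ *ᵥ z.2) :
        (ι → K) × (ι → K))) ⁻¹' A) ×ˢ B) = μ₁ (A ×ˢ B))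
    (hinv₂ : ∀ B ∈ 𝔅, ∀ (g : GL ι K) (A : Set ((ι → K) × (ι → K))), MeasurableSet A →
      μ₂ (((fun z => (((g : Matrix ι ι K) *ᵥ z.1, ((g⁻¹ : GL ι K) : Matrix ι ι K)ᵀ *ᵥ z.2) :
        (ι → K) × (ι → K))) ⁻¹' A) ×ˢ B) = μ₂ (A ×ˢ B))
    (hcar₁ : ∀ B ∈ 𝔅, μ₁ ({z : (ι → K) × (ι → K) | z.1 ⬝ᵥ z.2 = b ∧ z.1 ≠ 0 ∧ z.2 ≠ 0}ᶜ ×ˢ B) = 0)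
    (hcar₂ : ∀ B ∈ 𝔅, μ₂ ({z : (ι → K) × (ι → K) | z.1 ⬝ᵥ z.2 = b ∧ z.1 ≠ 0 ∧ z.2 ≠ 0}ᶜ ×ˢ B) = 0)
    (hvan : ∀ B ∈ 𝔅, ∀ c₁ c₂ : ℝ≥0,
      (∀ A : Set ((ι → K) × (ι → K)), MeasurableSet A → μ₁ (A ×ˢ B) = c₁ * fibreMeasure μ hι b A) →
      (∀ A : Set ((ι → K) × (ι → K)), MeasurableSet A → μ₂ (A ×ˢ B) = c₂ * fibreMeasure μ hι b A) →
      (c₁ : ℝ) - κ * c₂ = 0) :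
    μ₁ = κ • μ₂ := by
  refine measure_eq_smul_of_rect_eq 𝔅 h𝔅pi h𝔅gen Yc hYc hYmono hYu μ₁ μ₂ κ (fun n => hfin₁ _ (hYc n) _
    ((isCompact_piPrimePowBall _).prod (isCompact_piPrimePowBall _))) fun B hB A hA => ?_
  obtain ⟨c₁, c₂, hc₁, hc₂, -⟩ := exists_rect_eq_mul_fibreMeasure_sub μ hι b μ₁ μ₂ κ (hfin₁ B hB) (hfin₂ B hB)
    (hinv₁ B hB) (hinv₂ B hB) (hcar₁ B hB) (hcar₂ B hB)
  have h0 := hvan B hB c₁ c₂ hc₁ hc₂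
  have hceq : (c₁ : ℝ≥0∞) = κ * c₂ := by
    have h1 : (c₁ : ℝ) = κ * c₂ := sub_eq_zero.1 h0
    have h2 : c₁ = κ * c₂ := by exact_mod_cast h1
    rw [h2, ENNReal.coe_mul]
  rw [hc₁ A hA, hc₂ A hA, ← mul_assoc, hceq]

end Literature.NumberTheory.Weil1965.SplitPlace
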